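import Summits.SmoothPoincare4.SmoothPoincare4.Theorems.ConvexBisectionAcyclicBisectionExistsHgapCharacterSign
import HarnessLib

/-!
# Dual handles, node `Hgap` part C: the orientation-character clause `Hχ` at a seam point
(sub-goal of stub `stub_T3_dualPresentation` (T3) ▸ node `Hgap` ▸ part C, line `modp-braid-orbits`, crux
`ConvexBisection.AcyclicBisectionExists`, item stmt-SmoothPoincare4-10508; wave 6, lead c5, worker G3;
registered sub-goal `helper_Hgap_character`)

Sequel of `…HgapCharacterSign.lean`.  The clause `Hχ(s)` of the node `Hgap` (2nd hypothesis of
`T3_of_two_pieces`, `…T3AssemblyClosed.lean`) at a seam point `b₁.incl y₀ = D₁.jA a₁`,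
`b₂.incl (φ y₀) = D₂p.jA a₂`:
`∀ uu v₁ v₂, (d(b₁.incl) uu = d(D₁.jA) v₁) → (d(b₂.incl ∘ φ) uu = d(D₂p.jA) v₂) → IsPosBdryFrame q₁ a₁ v₁ →
0 < ε · det4 (∇rho (a₂), ambientC (v₂ 0), ambientC (v₂ 1), ambientC (v₂ 2))`.
Here it is PROVED with `ε := twistSign D bX Ψ y₁` (X3's twisting sign of the seam at the base point `y₁`
under `a₁`) for every presentation `D₂p` whose seam correspondence near `y₀` is a fibred flattening
`Γ = R_1 ∘ seamB D bX Ψ` of X3's seam map (`R` any `rho`-preserving ambient isotopy of the cap; for the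
node `Hgap`, `R` = G1's straightening `strIso g m hm` and the local seam formula comes from the seam
clause `hseam` and G1's `jA`-bridge):

* §1 `exists_sideLift`: the lift `L = b₁.incl⁻¹ ∘ D₁.jA` of the base boundary to `∂X₁` near a point off
  the cores of `q₁` (smooth, `d(b₁.incl) ∘ dL = d(D₁.jA) ∘ (0, ·)`; X3's `seamLift` for an arbitrary
  boundary datum);
* §2 `ambientC_eq_bdDeriv_of_seamFormula`: under the local seam formula
  `b₂.incl (φ (L y')) = D₂p.jA (Γ y')` near `y₁`, corresponding frames satisfy
  `ambientC q₂ a₂ (v₂ k) = bdDeriv Γ y₁ (ambientC q₁ a₁ (v₁ k))` (chain rule, `d(jA)` injective);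
* §3 `Hgap_character` (registered as `helper_Hgap_character`): the clause, by
  `twistSign_mul_det4_flatten_pos`.

Everything is proved; no named facts, no `sorry`.

## References
* R. İ. Baykur, *Kähler decomposition of 4-manifolds*, AGT 6 (2006), §2.3, proof of Thm. 5.1. [Baykur2006]
* J. M. Lee, *Introduction to Smooth Manifolds* (2013), Thm. 5.11, Cor. 5.30. [LeeSmoothManifolds2013]
-/

noncomputable section

-- the prescribed namespace `Summit.<P>.<Sub>.…` duplicates `SmoothPoincare4` (P = Sub)
set_option linter.dupNamespace false

open scoped Manifold ContDiff Topology RealInnerProductSpace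

namespace Summit.SmoothPoincare4.SmoothPoincare4.Theorems.AcyclicBisectionExists.ModpBraidOrbits

open Set Function Metric Module Filter
open Literature.Topology.FourManifolds Literature.Topology.FourManifolds.HandleAttachingMap
  Literature.Topology.FourManifolds.BoundaryManifold Literature.Topology.FourManifolds.LefschetzBase
  Literature.Geometry.Symplectic

variable {g : ℕ}

/-! ## §1 The lift of the base boundary to `∂X₁` through `D₁.jA` -/

section Lift

variable {X₁ : Type} [TopologicalSpace X₁] [ChartedSpace (EuclideanHalfSpace 4) X₁] [IsManifold (𝓡∂ 4) ∞ X₁]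
  {ι₁ : Type} [Finite ι₁] {q₁ : ι₁ → HandleAttachingMap 3 2 (Base g)}
  (D₁ : MultiAttachmentData q₁ (𝓡∂ 4) X₁) (b₁ : BoundaryData (𝓡∂ 4) X₁ (𝓡 3)) [Nonempty b₁.carrier]

-- adapted from `…SeamTwistSignLift.lean` (X3: `jAY`, `seamLift`, `hasMFDerivAt_jAY`, `mfderiv_incl_seamLift`)
/-- **The lift of the base boundary to `∂X₁` near a point off the cores.**  For multi-attachment data `D₁`
over the cap and ANY boundary datum `b₁` of `X₁` there is `L : ∂ Base g → b₁.carrier` with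
`L y' = b₁.incl⁻¹ (D₁.jA y')` off the cores of `q₁`, smooth at `y₁`, and
`d(b₁.incl)_{L y₁} (dL_{y₁} e) = d(D₁.jA)_{y₁} (0, e)`. [cite: LeeSmoothManifolds2013, Thm. 5.11] -/
theorem exists_sideLift (y₁ : (bBase g).carrier) (hy₁ : (y₁.1 : Base g) ∈ coresComplement q₁) :
    ∃ L : (bBase g).carrier → b₁.carrier,
      (∀ (y' : (bBase g).carrier) (h' : (y'.1 : Base g) ∈ coresComplement q₁),
        L y' = b₁.inclInv (D₁.jA ⟨y'.1, h'⟩)) ∧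
      ContMDiffAt (𝓡 3) (𝓡 3) ∞ L y₁ ∧
      ∀ e : EuclideanSpace ℝ (Fin 3), mfderiv (𝓡 3) (𝓡∂ 4) b₁.incl (L y₁) (mfderiv (𝓡 3) (𝓡 3) L y₁ e) =
        mfderiv (𝓡∂ 4) (𝓡∂ 4) D₁.jA ⟨y₁.1, hy₁⟩ (consZeroL 3 e) := by
  classical
  -- the open set of boundary points off the cores
  obtain ⟨U, hU, hUmem⟩ : ∃ U : Set (bBase g).carrier, IsOpen U ∧
      ∀ y' : (bBase g).carrier, y' ∈ U ↔ (y'.1 : Base g) ∈ coresComplement q₁ :=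
    ⟨{y' | (y'.1 : Base g) ∈ coresComplement q₁},
      (coresComplement q₁).isOpen.preimage continuous_subtype_val, fun _ => Iff.rfl⟩
  have hyU : y₁ ∈ U := (hUmem y₁).2 hy₁
  -- `jA` read on the boundary, junk `D₁.jA y₁` on the cores
  set codr : (bBase g).carrier → ↥(coresComplement q₁) := fun y' =>
    if hy' : (y'.1 : Base g) ∈ coresComplement q₁ then ⟨y'.1, hy'⟩ else ⟨y₁.1, hy₁⟩ with hcodr
  set J : (bBase g).carrier → X₁ := fun y' => D₁.jA (codr y') with hJ
  set L : (bBase g).carrier → b₁.carrier := fun y' => b₁.inclInv (J y') with hL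
  have hcb : ∀ y', (𝓡∂ 4).IsBoundaryPoint ((codr y' : ↥(coresComplement q₁)) : Base g) := fun y' => by
    by_cases hy' : (y'.1 : Base g) ∈ coresComplement q₁
    · simp only [hcodr, dif_pos hy']; exact y'.2
    · simp only [hcodr, dif_neg hy']; exact y₁.2
  have hJb : ∀ y', J y' ∈ range b₁.incl := fun y' => by
    rw [b₁.range_incl]
    exact (isBoundaryPoint_jA_iff D₁ (codr y')).2 (hcb y')
  -- smoothness: `codr` is the inclusion of the open set `U` into the cores-complement near `y₁`
  have hcodrU : ContMDiffOn (𝓡 3) (𝓡∂ 4) ∞ codr U := by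
    intro y hy
    let UO : TopologicalSpace.Opens (bBase g).carrier := ⟨U, hU⟩
    have hinc : ContMDiff (𝓡 3) (𝓡∂ 4) ∞
        (fun x : UO => (⟨x.1.1, (hUmem x.1).1 x.2⟩ : ↥(coresComplement q₁))) := by
      rw [← ContMDiff.subtypeVal_comp_iff]
      exact (bBase g).isSmoothEmbedding.contMDiff.comp contMDiff_subtype_val
    have e : (fun x : UO => codr x) = fun x : UO => (⟨x.1.1, (hUmem x.1).1 x.2⟩ : ↥(coresComplement q₁)) :=
      funext fun x => by simp only [hcodr, dif_pos ((hUmem x.1).1 x.2)]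
    have hres : ContMDiff (𝓡 3) (𝓡∂ 4) ∞ (fun x : UO => codr x) := by rw [e]; exact hinc
    exact (contMDiffAt_subtype_iff.mp (hres ⟨y, hy⟩)).contMDiffWithinAt
  have hJU : ContMDiffOn (𝓡 3) (𝓡∂ 4) ∞ J U := D₁.hjA.contMDiff.comp_contMDiffOn hcodrU
  have hLU : ContMDiffOn (𝓡 3) (𝓡 3) ∞ L U := b₁.contMDiffOn_inclInv.comp hJU fun y' _ => hJb y'
  have hLs : ContMDiffAt (𝓡 3) (𝓡 3) ∞ L y₁ := hLU.contMDiffAt (hU.mem_nhds hyU)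
  refine ⟨L, fun y' h' => ?_, hLs, fun e => ?_⟩
  · show b₁.inclInv (D₁.jA (codr y')) = _
    simp only [hcodr, dif_pos h']
  · -- the differential: `b₁.incl ∘ L = J`, `dJ = d(jA) ∘ (0, ·)`
    have hfe : (fun y' => ((codr y' : ↥(coresComplement q₁)) : Base g)) =ᶠ[𝓝 y₁] (bBase g).incl := by
      filter_upwards [hU.mem_nhds hyU] with y' hy'
      show ((codr y' : ↥(coresComplement q₁)) : Base g) = y'.1
      simp only [hcodr, dif_pos ((hUmem y').1 hy')]
    have hf : HasMFDerivAt (𝓡 3) (𝓡∂ 4) (fun y' => ((codr y' : ↥(coresComplement q₁)) : Base g)) y₁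
        (consZeroL 3) :=
      (hasMFDerivAt_incl_boundaryData (n := 3) y₁).congr_of_eventuallyEq hfe
    have hcodr₁ : HasMFDerivAt (𝓡 3) (𝓡∂ 4) codr y₁ (consZeroL 3) :=
      hasMFDerivAt_codRestrict_opens (fun _ => rfl) hf
    have hya : codr y₁ = ⟨y₁.1, hy₁⟩ := by simp only [hcodr, dif_pos hy₁]
    have hjA : HasMFDerivAt (𝓡∂ 4) (𝓡∂ 4) D₁.jA (codr y₁) (mfderiv (𝓡∂ 4) (𝓡∂ 4) D₁.jA (codr y₁)) :=
      (mdifferentiableAt_jA D₁ _).hasMFDerivAt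
    have hJd : HasMFDerivAt (𝓡 3) (𝓡∂ 4) J y₁
        ((mfderiv (𝓡∂ 4) (𝓡∂ 4) D₁.jA ⟨y₁.1, hy₁⟩).comp (consZeroL 3)) := by
      have := hjA.comp y₁ hcodr₁
      rwa [hya] at this
    have hLJ : b₁.incl ∘ L = J := funext fun y' => b₁.incl_inclInv (by rw [← b₁.range_incl]; exact hJb y')
    have hLJ' : mfderiv (𝓡 3) (𝓡∂ 4) (b₁.incl ∘ L) y₁ = mfderiv (𝓡 3) (𝓡∂ 4) J y₁ := by rw [hLJ]
    have hLd : MDifferentiableAt (𝓡 3) (𝓡 3) L y₁ := hLs.mdifferentiableAt (by simp)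
    have hincl : MDifferentiableAt (𝓡 3) (𝓡∂ 4) b₁.incl (L y₁) :=
      b₁.isSmoothEmbedding.contMDiff.mdifferentiableAt (by simp)
    have hc : mfderiv (𝓡 3) (𝓡∂ 4) (b₁.incl ∘ L) y₁ =
        (mfderiv (𝓡 3) (𝓡∂ 4) b₁.incl (L y₁)).comp (mfderiv (𝓡 3) (𝓡 3) L y₁) := mfderiv_comp y₁ hincl hLd
    have := congrArg (fun Lm : EuclideanSpace ℝ (Fin 3) →L[ℝ] EuclideanSpace ℝ (Fin 4) => Lm e)
      (hc.symm.trans (hLJ'.trans hJd.mfderiv))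
    exact this

end Lift

/-! ## §2 Corresponding frames under a local seam formula -/

section Frames

variable {X₁ : Type} [TopologicalSpace X₁] [ChartedSpace (EuclideanHalfSpace 4) X₁] [IsManifold (𝓡∂ 4) ∞ X₁]
  {ι₁ : Type} [Finite ι₁] {q₁ : ι₁ → HandleAttachingMap 3 2 (Base g)}
  (D₁ : MultiAttachmentData q₁ (𝓡∂ 4) X₁) (b₁ : BoundaryData (𝓡∂ 4) X₁ (𝓡 3)) [Nonempty b₁.carrier]
  {W₂ : Type} [TopologicalSpace W₂] [ChartedSpace (EuclideanHalfSpace 4) W₂] [IsManifold (𝓡∂ 4) ∞ W₂]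
  {ι₂ : Type} [Finite ι₂] {q₂ : ι₂ → HandleAttachingMap 3 2 (Base g)}
  (D₂p : MultiAttachmentData q₂ (𝓡∂ 4) W₂) (b₂ : BoundaryData (𝓡∂ 4) W₂ (𝓡 3))
  (φ : b₁.carrier ≃ₘ⟮𝓡 3, 𝓡 3⟯ b₂.carrier)

/-- **Corresponding frames are related by the boundary ambient differential of the seam correspondence.**
Let `Γ : ∂ Base g → Base g` be smooth at `y₁` and suppose the LOCAL SEAM FORMULA
`b₂.incl (φ (b₁.incl⁻¹ (D₁.jA y'))) = D₂p.jA (Γ y')` for `y'` near `y₁`.  Then at the seam point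
`y₀ = b₁.incl⁻¹ (D₁.jA y₁)`, `a₁ = y₁`, `a₂ = Γ y₁`, every triple of corresponding frames
(`d(b₁.incl)_{y₀} uu = d(D₁.jA)_{a₁} v₁`, `d(b₂.incl ∘ φ)_{y₀} uu = d(D₂p.jA)_{a₂} v₂`) satisfies
`ambientC q₂ a₂ (v₂ k) = bdDeriv Γ y₁ (ambientC q₁ a₁ (v₁ k))` (chain rule; `d(b₁.incl)`, `d(D₂p.jA)` are
injective). [cite: LeeSmoothManifolds2013, Cor. 5.30] -/
theorem ambientC_eq_bdDeriv_of_seamFormula (Γ : (bBase g).carrier → Base g) (y₁ : (bBase g).carrier)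
    (hΓ : ContMDiffAt (𝓡 3) (𝓡∂ 4) ∞ Γ y₁) (a₁ : ↥(coresComplement q₁)) (ha₁ : (a₁ : Base g) = y₁.1)
    (y₀ : b₁.carrier) (hy₀ : b₁.incl y₀ = D₁.jA a₁) (a₂ : ↥(coresComplement q₂))
    (ha₂ : (a₂ : Base g) = Γ y₁)
    (HΓ : ∀ᶠ y' in 𝓝 y₁, ∃ (h₁' : (y'.1 : Base g) ∈ coresComplement q₁) (h₂' : Γ y' ∈ coresComplement q₂),
      b₂.incl (φ (b₁.inclInv (D₁.jA ⟨y'.1, h₁'⟩))) = D₂p.jA ⟨Γ y', h₂'⟩)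
    (uu : Fin 3 → EuclideanSpace ℝ (Fin 3)) (v₁ v₂ : Fin 3 → EuclideanSpace ℝ (Fin 4))
    (hF1 : ∀ k, mfderiv (𝓡 3) (𝓡∂ 4) b₁.incl y₀ (uu k) = mfderiv (𝓡∂ 4) (𝓡∂ 4) D₁.jA a₁ (v₁ k))
    (hF2 : ∀ k, mfderiv (𝓡 3) (𝓡∂ 4) (b₂.incl ∘ φ) y₀ (uu k) = mfderiv (𝓡∂ 4) (𝓡∂ 4) D₂p.jA a₂ (v₂ k))
    (k : Fin 3) :
    ambientC q₂ a₂ (v₂ k) = bdDeriv g Γ y₁ (ambientC q₁ a₁ (v₁ k)) := by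
  classical
  obtain ⟨a, ha⟩ := a₁
  obtain ⟨b, hb⟩ := a₂
  simp only at ha₁ ha₂
  subst ha₁ ha₂
  -- the `v₁ k` are tangent to the boundary
  have hv0 : ∀ k, v₁ k 0 = 0 := fun k =>
    (mem_boundaryTangentSpace_iff _).1 (mem_boundaryTangentSpace_of_mfderiv_jA D₁ ⟨y₁.1, ha⟩ y₁.2
      (by rw [← hF1 k]; exact mfderiv_incl_mem_boundaryTangentSpace b₁ y₀ (uu k)))
  -- the lift on side 1; `y₀ = L y₁`, `uu k = dL (tail (v₁ k))`
  obtain ⟨L, hLf, hLs, hLd⟩ := exists_sideLift D₁ b₁ y₁ ha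
  have hjb : D₁.jA ⟨y₁.1, ha⟩ ∈ (𝓡∂ 4).boundary X₁ := (isBoundaryPoint_jA_iff D₁ ⟨y₁.1, ha⟩).2 y₁.2
  have hLy : L y₁ = y₀ :=
    b₁.injective_incl (by rw [hLf y₁ ha, b₁.incl_inclInv hjb, hy₀])
  have hLmd : MDifferentiableAt (𝓡 3) (𝓡 3) L y₁ := hLs.mdifferentiableAt (by simp)
  have huu : ∀ k, uu k = mfderiv (𝓡 3) (𝓡 3) L y₁ (tail 3 (v₁ k)) := fun k => by
    apply injective_mfderiv_boundaryIncl b₁ y₀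
    rw [hF1 k, ← hLy, hLd, consZeroL_apply, consCLE_tail_of_eq_zero 3 (hv0 k)]
  -- the seam correspondence into the cores-complement of `q₂`
  have hev : ∀ᶠ y' in 𝓝 y₁, Γ y' ∈ coresComplement q₂ := HΓ.mono fun y' ⟨_, h₂', _⟩ => h₂'
  set Γc : (bBase g).carrier → ↥(coresComplement q₂) := fun y' =>
    if h' : Γ y' ∈ coresComplement q₂ then ⟨Γ y', h'⟩ else ⟨Γ y₁, hb⟩ with hΓc
  have hΓc₁ : Γc y₁ = ⟨Γ y₁, hb⟩ := by simp only [hΓc, dif_pos hb]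
  have hΓmd : MDifferentiableAt (𝓡 3) (𝓡∂ 4) Γ y₁ := hΓ.mdifferentiableAt (by simp)
  have hfe : (fun y' => ((Γc y' : ↥(coresComplement q₂)) : Base g)) =ᶠ[𝓝 y₁] Γ := by
    filter_upwards [hev] with y' hy'
    show ((Γc y' : ↥(coresComplement q₂)) : Base g) = Γ y'
    simp only [hΓc, dif_pos hy']
  have hΓcd : HasMFDerivAt (𝓡 3) (𝓡∂ 4) Γc y₁ (mfderiv (𝓡 3) (𝓡∂ 4) Γ y₁) :=
    hasMFDerivAt_codRestrict_opens (fun _ => rfl) (hΓmd.hasMFDerivAt.congr_of_eventuallyEq hfe)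
  -- the local seam formula as an identity of maps near `y₁`
  have hId : ((b₂.incl ∘ φ) ∘ L) =ᶠ[𝓝 y₁] (D₂p.jA ∘ Γc) := by
    filter_upwards [HΓ] with y' hy'
    obtain ⟨h₁', h₂', he⟩ := hy'
    show b₂.incl (φ (L y')) = D₂p.jA (Γc y')
    rw [hLf y' h₁', he]
    simp only [hΓc, dif_pos h₂']
  -- differentiate both sides
  have hφ : MDifferentiableAt (𝓡 3) (𝓡 3) φ (L y₁) := φ.contMDiff.mdifferentiableAt (by simp)
  have hb₂ : MDifferentiableAt (𝓡 3) (𝓡∂ 4) b₂.incl (φ (L y₁)) :=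
    (b₂.isSmoothEmbedding.contMDiff _).mdifferentiableAt (by simp)
  have hbφ : MDifferentiableAt (𝓡 3) (𝓡∂ 4) (b₂.incl ∘ φ) (L y₁) := hb₂.comp (L y₁) hφ
  have hlhs : mfderiv (𝓡 3) (𝓡∂ 4) ((b₂.incl ∘ φ) ∘ L) y₁ =
      (mfderiv (𝓡 3) (𝓡∂ 4) (b₂.incl ∘ φ) (L y₁)).comp (mfderiv (𝓡 3) (𝓡 3) L y₁) :=
    mfderiv_comp y₁ hbφ hLmd
  have hjA₂ : HasMFDerivAt (𝓡∂ 4) (𝓡∂ 4) D₂p.jA (Γc y₁) (mfderiv (𝓡∂ 4) (𝓡∂ 4) D₂p.jA (Γc y₁)) :=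
    (mdifferentiableAt_jA D₂p _).hasMFDerivAt
  have hrhs : mfderiv (𝓡 3) (𝓡∂ 4) (D₂p.jA ∘ Γc) y₁ =
      (mfderiv (𝓡∂ 4) (𝓡∂ 4) D₂p.jA ⟨Γ y₁, hb⟩).comp (mfderiv (𝓡 3) (𝓡∂ 4) Γ y₁) := by
    have := (hjA₂.comp y₁ hΓcd).mfderiv
    rwa [hΓc₁] at this
  have hD : mfderiv (𝓡 3) (𝓡∂ 4) ((b₂.incl ∘ φ) ∘ L) y₁ = mfderiv (𝓡 3) (𝓡∂ 4) (D₂p.jA ∘ Γc) y₁ :=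
    hId.mfderiv_eq
  rw [hlhs, hrhs, hLy] at hD
  -- `v₂ k = dΓ (tail (v₁ k))`
  have hv₂ : v₂ k = mfderiv (𝓡 3) (𝓡∂ 4) Γ y₁ (tail 3 (v₁ k)) := by
    apply injective_mfderiv_jA D₂p ⟨Γ y₁, hb⟩
    have h1 : mfderiv (𝓡 3) (𝓡∂ 4) (b₂.incl ∘ φ) y₀ (mfderiv (𝓡 3) (𝓡 3) L y₁ (tail 3 (v₁ k))) =
        mfderiv (𝓡∂ 4) (𝓡∂ 4) D₂p.jA ⟨Γ y₁, hb⟩ (mfderiv (𝓡 3) (𝓡∂ 4) Γ y₁ (tail 3 (v₁ k))) :=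
      congrArg (fun Lm : EuclideanSpace ℝ (Fin 3) →L[ℝ] EuclideanSpace ℝ (Fin 4) => Lm (tail 3 (v₁ k))) hD
    rw [← huu k, hF2 k] at h1
    exact h1
  -- read in the ambient `ℝ⁴`
  rw [ambientC_eq_ambient, ambientC_eq_ambient, hv₂]
  show ambient g (Γ y₁) _ = bdDeriv g Γ y₁ (ambient g y₁.1 (v₁ k))
  rw [← bdDeriv_ambient hΓmd (tail 3 (v₁ k)), consZeroL_apply, consCLE_tail_of_eq_zero 3 (hv0 k)]

end Frames

/-! ## §3 The orientation-character clause `Hχ` at a seam point of a fibred flattening -/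

section Character

variable {ι : Type} [Finite ι] {h : ι → HandleAttachingMap 3 2 (Base g)}
  {X : Type} [TopologicalSpace X] [ChartedSpace (EuclideanHalfSpace 4) X] [IsManifold (𝓡∂ 4) ∞ X]
  (D : MultiAttachmentData h (𝓡∂ 4) X) (bX : BoundaryData (𝓡∂ 4) X (𝓡 3)) [Nonempty bX.carrier]
  (Ψ : bX.carrier ≃ₘ⟮𝓡 3, 𝓡 3⟯ (bBase g).carrier)
  (hpage : ∀ (y : bX.carrier) (a : ↥(coresComplement h)), bX.incl y = D.jA a →
    ∃ c : ℝ, 0 < c ∧ w g ((bBase g).incl (Ψ y)).1 = (c : ℂ) * w g (a : Base g).1)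
  {X₁ : Type} [TopologicalSpace X₁] [ChartedSpace (EuclideanHalfSpace 4) X₁] [IsManifold (𝓡∂ 4) ∞ X₁]
  {ι₁ : Type} [Finite ι₁] {q₁ : ι₁ → HandleAttachingMap 3 2 (Base g)}
  (D₁ : MultiAttachmentData q₁ (𝓡∂ 4) X₁) (b₁ : BoundaryData (𝓡∂ 4) X₁ (𝓡 3)) [Nonempty b₁.carrier]
  {W₂ : Type} [TopologicalSpace W₂] [ChartedSpace (EuclideanHalfSpace 4) W₂] [IsManifold (𝓡∂ 4) ∞ W₂]
  {ι₂ : Type} [Finite ι₂] {q₂ : ι₂ → HandleAttachingMap 3 2 (Base g)}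
  (D₂p : MultiAttachmentData q₂ (𝓡∂ 4) W₂) (b₂ : BoundaryData (𝓡∂ 4) W₂ (𝓡 3))
  (φ : b₁.carrier ≃ₘ⟮𝓡 3, 𝓡 3⟯ b₂.carrier)

include hpage in
/-- **The clause `Hχ` of the node `Hgap` at a seam point of a fibred flattening of the seam.**  Let `R` be a
`rho`-preserving ambient isotopy of the cap and `Γ = R_1 ∘ seamB D bX Ψ`; let `y₁` be a flat page point of
`∂ Base g` off the cores of `h` under the seam point `b₁.incl y₀ = D₁.jA a₁` (`a₁ = y₁`), `a₂ = Γ y₁`, and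
suppose the local seam formula `b₂.incl (φ (b₁.incl⁻¹ (D₁.jA y'))) = D₂p.jA (Γ y')` near `y₁`.  Then for ALL
corresponding frames `(uu, v₁, v₂)` with `IsPosBdryFrame q₁ a₁ v₁`:
`0 < twistSign y₁ · det4 (∇rho (a₂), ambientC (v₂ 0), ambientC (v₂ 1), ambientC (v₂ 2))` — the orientation
character of the seam is X3's twisting sign. [cite: Baykur2006, §2.3] -/
theorem Hgap_character (R : AmbientIsotopy (𝓡∂ 4) (Base g))
    (hρR : ∀ (t : ℝ) (x : Base g), rho g (R.toFun t x).1 = rho g x.1)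
    (y₁ : (bBase g).carrier) (hy₁ : (y₁.1 : Base g) ∈ coresComplement h) (hflat : ‖cx y₁.1.1‖ ^ 2 < 4)
    (a₁ : ↥(coresComplement q₁)) (ha₁ : (a₁ : Base g) = y₁.1) (y₀ : b₁.carrier)
    (hy₀ : b₁.incl y₀ = D₁.jA a₁) (a₂ : ↥(coresComplement q₂))
    (ha₂ : (a₂ : Base g) = R.toFun 1 (seamB D bX Ψ y₁))
    (HΓ : ∀ᶠ y' in 𝓝 y₁, ∃ (h₁' : (y'.1 : Base g) ∈ coresComplement q₁)
      (h₂' : R.toFun 1 (seamB D bX Ψ y') ∈ coresComplement q₂),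
      b₂.incl (φ (b₁.inclInv (D₁.jA ⟨y'.1, h₁'⟩))) = D₂p.jA ⟨R.toFun 1 (seamB D bX Ψ y'), h₂'⟩)
    (uu : Fin 3 → EuclideanSpace ℝ (Fin 3)) (v₁ v₂ : Fin 3 → EuclideanSpace ℝ (Fin 4))
    (hF1 : ∀ k, mfderiv (𝓡 3) (𝓡∂ 4) b₁.incl y₀ (uu k) = mfderiv (𝓡∂ 4) (𝓡∂ 4) D₁.jA a₁ (v₁ k))
    (hF2 : ∀ k, mfderiv (𝓡 3) (𝓡∂ 4) (b₂.incl ∘ φ) y₀ (uu k) = mfderiv (𝓡∂ 4) (𝓡∂ 4) D₂p.jA a₂ (v₂ k))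
    (hpos : IsPosBdryFrame q₁ a₁ v₁) :
    0 < (twistSign D bX Ψ y₁ : ℝ) * det4 (gradient (rho g) (a₂ : Base g).1) (ambientC q₂ a₂ (v₂ 0))
      (ambientC q₂ a₂ (v₂ 1)) (ambientC q₂ a₂ (v₂ 2)) := by
  have hΓ : ContMDiffAt (𝓡 3) (𝓡∂ 4) ∞ (R.toFun 1 ∘ seamB D bX Ψ) y₁ :=
    ((R.contMDiff_toFun 1) _).comp y₁ (contMDiffAt_seamB D bX Ψ hy₁)
  have hfr := ambientC_eq_bdDeriv_of_seamFormula D₁ b₁ D₂p b₂ φ (R.toFun 1 ∘ seamB D bX Ψ) y₁ hΓ a₁ ha₁ y₀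
    hy₀ a₂ ha₂ HΓ uu v₁ v₂ hF1 hF2
  rw [hfr 0, hfr 1, hfr 2]
  -- the frame `V := ambientC q₁ a₁ v₁` is tangent and positive at `y₁`
  obtain ⟨a, ha⟩ := a₁
  simp only at ha₁
  subst ha₁
  have hv0 : ∀ k, v₁ k 0 = 0 := fun k =>
    (mem_boundaryTangentSpace_iff _).1 (mem_boundaryTangentSpace_of_mfderiv_jA D₁ ⟨y₁.1, ha⟩ y₁.2
      (by rw [← hF1 k]; exact mfderiv_incl_mem_boundaryTangentSpace b₁ y₀ (uu k)))
  have hρ₁ : rho g y₁.1.1 = 1 / 4 := (RegularSublevel.mem_boundary_iff _ _).1 y₁.2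
  have hV : ∀ k, fderiv ℝ (rho g) y₁.1.1 (ambientC q₁ ⟨y₁.1, ha⟩ (v₁ k)) = 0 := fun k => by
    rw [ambientC_eq_ambient]
    show fderiv ℝ (rho g) y₁.1.1 (ambient g y₁.1 (v₁ k)) = 0
    rw [fderiv_rho_ambient _ hρ₁, hv0 k, neg_zero]
  have key := twistSign_mul_det4_flatten_pos D bX Ψ hpage R hρR hy₁ hflat
    (fun k => ambientC q₁ ⟨y₁.1, ha⟩ (v₁ k)) hV hpos
  rw [ha₂]
  exact key

end Character

/-! ## §4 The registered package -/

/-- **Sub-goal `helper_Hgap_character` of stub `stub_T3_dualPresentation`** (T3 ▸ node `Hgap` ▸ part C;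
wave 6, lead c5, worker G3): **the orientation-character clause `Hχ` of `Hgap` at a seam point of a fibred
flattening `R_1 ∘ seamB` of the seam map holds with the sign `twistSign y₁`** (X3's twisting sign of the
seam at the base point `y₁`, flat and off the cores), for every presentation `D₂p` of the second piece
whose seam correspondence near the point is `R_1 ∘ seamB` (local seam formula), `R` any `rho`-preserving
ambient isotopy of the cap. [cite: Baykur2006, §2.3] -/
theorem helper_Hgap_character : ∀ (g : ℕ) (ι : Type) [Finite ι] (h : ι → Literature.Topology.FourManifolds.HandleAttachingMap 3 2 (Literature.Topology.FourManifolds.LefschetzBase.Base g)) (X : Type) [TopologicalSpace X] [ChartedSpace (EuclideanHalfSpace 4) X] [IsManifold (𝓡∂ 4) ∞ X] (D : Literature.Topology.FourManifolds.HandleAttachingMap.MultiAttachmentData h (𝓡∂ 4) X) (bX : Literature.Topology.FourManifolds.BoundaryData (𝓡∂ 4) X (𝓡 3)) [Nonempty bX.carrier] (Ψ : bX.carrier ≃ₘ⟮𝓡 3, 𝓡 3⟯ (Literature.Topology.FourManifolds.LefschetzBase.bBase g).carrier), (∀ (y : bX.carrier) (a : ↥(Literature.Topology.FourManifolds.HandleAttachingMap.coresComplement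 h)), bX.incl y = D.jA a → ∃ c : ℝ, 0 < c ∧ Literature.Topology.FourManifolds.LefschetzBase.w g ((Literature.Topology.FourManifolds.LefschetzBase.bBase g).incl (Ψ y)).1 = (c : ℂ) * Literature.Topology.FourManifolds.LefschetzBase.w g (a : Literature.Topology.FourManifolds.LefschetzBase.Base g).1) → ∀ (ι₁ : Type) [Finite ι₁] (q₁ : ι₁ → Literature.Topology.FourManifolds.HandleAttachingMap 3 2 (Literature.Topology.FourManifolds.LefschetzBase.Base g)) (X₁ : Type) [TopologicalSpace X₁] [ChartedSpace (EuclideanHalfSpace 4) X₁] [IsManifold (𝓡∂ 4) ∞ X₁] (D₁ : Literature.Topology.FourManifolds.HandleAttachingMap.MultiAttachmentData q₁ (𝓡∂ 4) X₁) (b₁ : Literature.Topology.FourManifolds.BoundaryData (𝓡∂ 4) X₁ (𝓡 3)) [Nonempty b₁.carrier] (ι₂ : Type) [Finite ι₂] (q₂ : ι₂ → Literature.Topology.FourManifolds.HandleAttachingMap 3 2 (Literature.Topology.FourManifolds.LefschetzBase.Base g)) (W₂ : Type) [TopologicalSpace W₂] [ChartedSpace (EuclideanHalfSpace 4) W₂]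 [IsManifold (𝓡∂ 4) ∞ W₂] (D₂p : Literature.Topology.FourManifolds.HandleAttachingMap.MultiAttachmentData q₂ (𝓡∂ 4) W₂) (b₂ : Literature.Topology.FourManifolds.BoundaryData (𝓡∂ 4) W₂ (𝓡 3)) (φ : b₁.carrier ≃ₘ⟮𝓡 3, 𝓡 3⟯ b₂.carrier) (R : Literature.Topology.FourManifolds.AmbientIsotopy (𝓡∂ 4) (Literature.Topology.FourManifolds.LefschetzBase.Base g)), (∀ (t : ℝ) (x : Literature.Topology.FourManifolds.LefschetzBase.Base g), Literature.Topology.FourManifolds.LefschetzBase.rho g (R.toFun t x).1 = Literature.Topology.FourManifolds.LefschetzBase.rho g x.1) → ∀ y₁ a₁ y₀ a₂, a₂.1 = R.toFun 1 (Summit.SmoothPoincare4.SmoothPoincare4.Theorems.AcyclicBisectionExists.ModpBraidOrbits.seamB D bX Ψ y₁) → b₁.incl y₀ = D₁.jA a₁ → a₁.1 = y₁.1 → y₁.1 ∈ Literature.Topology.FourManifolds.HandleAttachingMap.coresComplement h → ‖Literature.Topology.FourManifolds.LefschetzBase.cx y₁.1.1‖ ^ 2 < 4 → (∀ᶠ y'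 in nhds y₁, ∃ (h₁' : y'.1 ∈ Literature.Topology.FourManifolds.HandleAttachingMap.coresComplement q₁) (h₂' : R.toFun 1 (Summit.SmoothPoincare4.SmoothPoincare4.Theorems.AcyclicBisectionExists.ModpBraidOrbits.seamB D bX Ψ y') ∈ Literature.Topology.FourManifolds.HandleAttachingMap.coresComplement q₂), b₂.incl (φ (b₁.inclInv (D₁.jA ⟨y'.1, h₁'⟩))) = D₂p.jA ⟨R.toFun 1 (Summit.SmoothPoincare4.SmoothPoincare4.Theorems.AcyclicBisectionExists.ModpBraidOrbits.seamB D bX Ψ y'), h₂'⟩) → ∀ (uu : Fin 3 → EuclideanSpace ℝ (Fin 3)) (v₁ v₂ : Fin 3 → EuclideanSpace ℝ (Fin 4)), (∀ k, mfderiv (𝓡 3) (𝓡∂ 4) b₁.incl y₀ (uu k) = mfderiv (𝓡∂ 4) (𝓡∂ 4) D₁.jA a₁ (v₁ k)) → (∀ k, mfderiv (𝓡 3) (𝓡∂ 4) (b₂.incl ∘ φ) y₀ (uu k) = mfderiv (𝓡∂ 4) (𝓡∂ 4) D₂p.jA a₂ (v₂ k)) → Literature.Geometry.Symplectic.IsPosBdryFrame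 q₁ a₁ v₁ → 0 < (Summit.SmoothPoincare4.SmoothPoincare4.Theorems.AcyclicBisectionExists.ModpBraidOrbits.twistSign D bX Ψ y₁ : ℝ) * Literature.Geometry.Symplectic.det4 (gradient (Literature.Topology.FourManifolds.LefschetzBase.rho g) a₂.1.1) (Literature.Geometry.Symplectic.ambientC q₂ a₂ (v₂ 0)) (Literature.Geometry.Symplectic.ambientC q₂ a₂ (v₂ 1)) (Literature.Geometry.Symplectic.ambientC q₂ a₂ (v₂ 2)) :=
  fun _ _ _ _ _ _ _ _ D bX _ Ψ hpage _ _ _ _ _ _ _ D₁ b₁ _ _ _ _ _ _ _ _ D₂p b₂ φ R hρR y₁ a₁ y₀ a₂ ha₂ hy₀ ha₁ hy₁ hflat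
      HΓ uu v₁ v₂ hF1 hF2 hpos =>
    Hgap_character D bX Ψ hpage D₁ b₁ D₂p b₂ φ R hρR y₁ hy₁ hflat a₁ ha₁ y₀ hy₀ a₂ ha₂ HΓ uu v₁ v₂ hF1 hF2 hpos

end Summit.SmoothPoincare4.SmoothPoincare4.Theorems.AcyclicBisectionExists.ModpBraidOrbits

end
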